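import Literature.AlgebraicGeometry.FundamentalGroup.FiniteEtaleQbarWeakDescent
import Literature.AlgebraicGeometry.FundamentalGroup.RiemannExistenceCovering
import Literature.AlgebraicGeometry.FundamentalGroup.RiemannExistenceZariskiLocal
import Literature.AlgebraicGeometry.FundamentalGroup.RiemannExistenceContinuousRational
import Literature.AlgebraicGeometry.HodgeTheory.HodgeGenericQbarDescentFiniteMonodromyInputs
import Literature.AlgebraicGeometry.HodgeTheory.HodgeGenericQbarDescentWeakDescent
import Literature.AlgebraicGeometry.HodgeTheory.QbarFamilyLocalSystem
import Literature.AlgebraicGeometry.Motives.ComplexPointsManifold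
import Literature.AlgebraicGeometry.Resolution.FiniteBirationalNormal
import Literature.AlgebraicGeometry.Resolution.RegularLocalRingsNormal
import Literature.AlgebraicTopology.Homotopy.ManifoldStronglyLocallyContractible
import Literature.Topology.CoveringSpaces.NormalSubgroupCovering
import HarnessLib

/-!
# Riemann existence with descent to `ℚ̄`, finite-index form: reduction to the two theorems of SGA 1

Topic `Literature/AlgebraicGeometry/FundamentalGroup`; proof file (theorems only, no definition, no
named fact) for the named fact `riemannExistence_qbarDescent_of_finiteIndex`
(`RiemannExistenceQbarDescent.lean`).  That fact is, as its docstring says, the conjunction of five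
printed theorems: (1) the classification of covering spaces [HatcherAT2002, Prop. 1.36, Prop. 1.32,
Thm. 1.38], (2) Riemann's existence theorem [SGA1, Exp. XII Thm. 5.1], (3) descent of finite étale
covers along `ℚ̄ ⊂ ℂ` [SGA1, Exp. XIII Prop. 4.6], (4) integrality of connected étale covers of a
normal scheme [SGA1, Exp. I Prop. 10.1] and (5) quasi-projectivity of finite covers [EGA II 6.1.11].
Here (1), (4), (5) and all the glue are PROVED, so that the fact follows from (2) and (3) ALONE, each
in its standard covering-space shape — verbatim the hypotheses `hRiemann`, `hDescent` of the tree's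
`HodgeTheory.finiteCovering_descends_to_qbar_of_riemannExistence_of_smooth`:

* `riemannExistence_qbarDescent_of_finiteIndex_of_riemannExistence_of_descent (hRiemann) (hDescent)`;
* `riemannExistence_qbarDescent_of_finiteIndex_of_coveringInput (hRE)` — the same from the single
  "covering input" of `HodgeTheory.voisin2007_algebraic_of_finite_monodromyOrbit_of_qbar_of_coveringInput`
  (every connected finite covering of `S(ℂ)` is `S''₀(ℂ)` over `S(ℂ)` for a finite étale
  quasi-projective `S''₀ → S₀` over `ℚ̄`), through which both other reductions factor;
* `riemannExistence_qbarDescent_of_finiteIndex_of_riemannExistence_of_weakDescent (hRiemann) (hDescent)`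
  — the same with (3) weakened to descent UP TO HOMEOMORPHISM over `S(ℂ)` (all that is consumed; the
  form delivered by spreading out and specialisation,
  `HodgeTheory.finiteCovering_descends_to_qbar_of_riemannExistence_of_weakDescent`).

The proof follows the printed road.  Let `S = S₀ ⊗_σ ℂ`, `s ∈ S(ℂ)`, `H ≤ π₁(S(ℂ), s)` of finite
index (the fact phrases `π₁` on the subspace `univ ⊆ S(ℂ)`, and so do we).
(i) `S(ℂ)` is a connected topological `2d`-manifold — `S` is smooth of one relative dimension `d`
(`HodgeTheory.exists_smoothOfRelativeDimension_baseChangeHom`), the algebraic charts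
`Motives.ComplexPoints.chartedSpace` (Serre, GAGA §2) make `S(ℂ)` strongly locally contractible
(`stronglyLocallyContractibleSpace_of_chartedSpace_normedSpace`) and it is path connected
(`HodgeTheory.pathConnectedSpace_complexPoints_baseChangeHom`, SGA1 XII 2.4).
(ii) Hatcher Prop. 1.36/1.32 for the normal core `N ⊴ π₁` of `H` (still of finite index): the
quotient `X̃ ⧸ N` of the universal cover is a path connected covering `q : T → S(ℂ)` with finite
fibres, a point `t` over `s`, and `q_* π₁(T, t) ⊆ N ⊆ H`
(`Topology.CoveringSpaces.UniversalCover.exists_covering_of_normal`).  We deviate from Hatcher only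
in dividing by the normal core rather than by `H` itself (the fact claims `⊆ H` only), which makes
`T → S(ℂ)` the quotient covering map of a group action.
(iii) Riemann existence and descent, with (4) and (5) proved
(`HodgeTheory.finiteCovering_descends_to_qbar_of_riemannExistence_of_smooth`): `T ≃ₜ S₀'(ℂ)` over
`S(ℂ)` for a finite étale `g₀ : S₀' ⟶ S₀` over `ℚ̄` with `S₀'` quasi-projective.
(iv) `S₀' ⊗_σ ℂ` is irreducible since its complex points `≃ₜ T` are connected
(`HodgeTheory.irreducibleSpace_baseChangeHom_obj_left_of_connectedSpace_complexPoints`), `s'` is the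
point matching `t`, and a loop at `s'` is a loop at `t`, whose image lies in `N ⊆ H` by (ii).

Further reductions (later in the file), each consuming less: `…_of_riemannExistence` (Riemann
existence alone, descent (3) being replaced by the PROVED weak descent of
`FiniteEtaleQbarWeakDescent.lean`), `…_of_riemannExistence_finiteCovering` (the tree's named fact),
`…_of_riemannExistence_smooth` / `…_smoothAffine` (Riemann existence for smooth irreducible
(affine) `ℂ`-schemes only, via the Zariski-localness of `RiemannExistenceZariskiLocal.lean`),
`…_of_charPolys` (Theorem A of `RiemannExistenceCharPoly.lean`: it suffices that the sheets of every
finite covering be separated by continuous functions with REGULAR characteristic polynomials) and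
`…_of_integralSeparating` (Theorem B of `RiemannExistenceCharPolyIntegral.lean`: continuous
functions INTEGRAL over `Γ(S, 𝒪_S)` separating one fibre suffice) and `…_of_algebraicSeparating`
(Theorem B′ of `RiemannExistenceContinuousRational.lean`: continuous functions ALGEBRAIC over
`Γ(S, 𝒪_S)` — any non-zero polynomial relation — separating one fibre suffice) and its Zariski-local
form `…_of_locallyAlgebraicSeparating` (the same on an affine open neighbourhood `U ∋ P₀`, with `h`
continuous on `q⁻¹(U(ℂ))` and algebraic over `Γ(S, U)` — the shape produced by weighted `L²`
estimates in étale coordinates on `U`).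

What is NOT here: the transcendental heart of (2) — the existence, on a finite covering `T` of
`S(ℂ)`, of continuous functions algebraic over `Γ(S, U)` on an affine open `U ∋ P₀` separating the
points of the fibre over `P₀` (Grauert–Remmert and GAGA in SGA1; Hörmander's `L²` theory
analytically). It is proved downstream, by Hörmander's weighted `L²` estimates on the flat Riemann
domain `q⁻¹(U(ℂ))` in étale coordinates, as `SmoothAffine.exists_locallyAlgebraicSeparating`
(`RiemannExistenceSmoothAffine.lean`, on top of `RiemannExistenceSmoothAffineCore.lean` and
`RiemannExistenceEtaleCoordinates.lean`), and the discharge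
`riemannExistence_qbarDescent_of_finiteIndex_holds` (= `…_of_locallyAlgebraicSeparating` applied to
it) lives in `RiemannExistenceSmoothAffine.lean`, which imports this file.

## References

* [HatcherAT2002] A. Hatcher, Algebraic Topology, CUP 2002, §1.3 Prop. 1.32 (p. 61), Prop. 1.36
  (pp. 68–69), Thm. 1.38 (p. 70).
* [SGA1] A. Grothendieck, M. Raynaud, SGA 1 (arXiv:math/0206203), Exp. XII Thm. 5.1 (p. 333),
  Prop. 2.4; Exp. XIII Prop. 4.6 (pp. 421–422); Exp. I Prop. 10.1.
* [SerreGAGA1956] J.-P. Serre, GAGA, Ann. Inst. Fourier 6 (1956), §2 n°5 Prop. 2.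
* [DeJong1996] A. J. de Jong, Publ. Math. IHÉS 83 (1996), 4.17 (quasi-projectivity of finite covers).
-/

noncomputable section

open CategoryTheory AlgebraicGeometry
open _root_.Topology
open Literature.Topology.CoveringSpaces

namespace Literature.AlgebraicGeometry.FundamentalGroup

open Literature.AlgebraicGeometry.Motives Literature.AlgebraicGeometry.HodgeTheory

/-- **`riemannExistence_qbarDescent_of_finiteIndex` from the covering input alone.**  Suppose
(`hRE`, verbatim the covering input of
`HodgeTheory.voisin2007_algebraic_of_finite_monodromyOrbit_of_qbar_of_coveringInput`) that every
connected finite topological covering `q : T → S(ℂ)`, `S = S₀ ⊗_σ ℂ` with `S₀` smooth irreducible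
quasi-projective over `ℚ̄`, is `S''₀(ℂ)` OVER `S(ℂ)` for a finite étale `g₀ : S''₀ ⟶ S₀` over `ℚ̄` with
`S''₀` quasi-projective — Riemann's existence theorem (SGA1 XII Thm. 5.1) followed by descent of
the cover to `ℚ̄` up to homeomorphism over `S(ℂ)` (a consequence of SGA1 XIII Prop. 4.6).  Then every
finite-index `H ≤ π₁(S(ℂ), s)` is realised as the fact demands: the covering of the connected
manifold `S(ℂ)` (path connected, strongly locally contractible: algebraic charts) attached to the
normal core `N` of `H` (Hatcher Prop. 1.36, finitely many sheets by Prop. 1.32, PROVED: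
`UniversalCover.exists_covering_of_normal`) is `S₀'(ℂ)` for such a `g₀ : S₀' ⟶ S₀`; `S₀' ⊗_σ ℂ` is
irreducible since its complex points `≃ₜ T` are connected
(`irreducibleSpace_baseChangeHom_obj_left_of_connectedSpace_complexPoints`); `s'` is the point
matching the base point `t` of `T`, and a loop at `s'` is a loop at `t`, whose image lies in
`N ⊆ H`.  We deviate from Hatcher only in dividing by the normal core rather than by `H`.
[cite: HatcherAT2002, §1.3 Thm. 1.38 with Prop. 1.36 (pp. 68–69) and Prop. 1.32 (p. 61)]
[cite: SGA1, Exp. XII Thm. 5.1 (p. 333) and Exp. XIII Prop. 4.6 (pp. 421–422)] -/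
theorem riemannExistence_qbarDescent_of_finiteIndex_of_coveringInput
    (hRE : ∀ (σ : AlgebraicClosure ℚ →+* ℂ) (S₀ : SchemeOver (AlgebraicClosure ℚ)),
      IsQuasiProjectiveOver S₀ → AlgebraicGeometry.Smooth S₀.hom → IrreducibleSpace S₀.left →
      ∀ (T : Type) [TopologicalSpace T] [ConnectedSpace T]
        (q : T → ComplexPoints ((baseChangeHom σ).obj S₀)),
        IsCoveringMap q → (∀ t, (q ⁻¹' {t}).Finite) →
        ∃ (S''₀ : SchemeOver (AlgebraicClosure ℚ)) (g₀ : S''₀ ⟶ S₀)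
          (Φ : ComplexPoints ((baseChangeHom σ).obj S''₀) ≃ₜ T),
          IsFinite g₀.left ∧ Etale g₀.left ∧ IsQuasiProjectiveOver S''₀ ∧
            ∀ z, q (Φ z) = AlgPoints.map ((baseChangeHom σ).map g₀) z) :
    riemannExistence_qbarDescent_of_finiteIndex := by
  intro σ S₀ hqp hirr hsm s H hH
  haveI := hirr
  haveI := hsm
  haveI := hH
  -- (i) `S(ℂ)` is a connected topological manifold: path connected, strongly locally contractible
  obtain ⟨d, hd⟩ := exists_smoothOfRelativeDimension_baseChangeHom σ S₀
  haveI := hd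
  haveI : LocallyOfFiniteType ((baseChangeHom σ).obj S₀).hom :=
    (hqp.baseChangeHom σ).locallyOfFiniteType
  letI := Motives.ComplexPoints.chartedSpace ((baseChangeHom σ).obj S₀) d
  haveI : StronglyLocallyContractibleSpace (ComplexPoints ((baseChangeHom σ).obj S₀)) :=
    Literature.AlgebraicTopology.Homotopy.stronglyLocallyContractibleSpace_of_chartedSpace_normedSpace
      (EuclideanSpace ℝ (Fin (2 * d))) _
  haveI : PathConnectedSpace (ComplexPoints ((baseChangeHom σ).obj S₀)) :=
    pathConnectedSpace_complexPoints_baseChangeHom σ hqp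
  -- the fact's `π₁` lives on the subspace `univ ⊆ S(ℂ)`
  haveI : StronglyLocallyContractibleSpace
      (Set.univ : Set (ComplexPoints ((baseChangeHom σ).obj S₀))) :=
    isOpen_univ.stronglyLocallyContractibleSpace
  haveI : PathConnectedSpace (Set.univ : Set (ComplexPoints ((baseChangeHom σ).obj S₀))) :=
    isPathConnected_iff_pathConnectedSpace.mp isPathConnected_univ
  -- (ii) the covering attached to the normal core `N ⊴ π₁(S(ℂ), s)` of `H` (Hatcher 1.36, 1.32)
  obtain ⟨T, _, q, hqc, t, ht, hcov, hTpc, hfin, hloop⟩ :=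
    UniversalCover.exists_covering_of_normal
      (X := (Set.univ : Set (ComplexPoints ((baseChangeHom σ).obj S₀))))
      (x₀ := ⟨s, Set.mem_univ s⟩) H.normalCore
  haveI := hTpc
  let φ := Homeomorph.Set.univ (ComplexPoints ((baseChangeHom σ).obj S₀))
  have hcov' : IsCoveringMap (φ ∘ q) := hcov.homeomorph_comp φ
  have hfin' : ∀ x, ((φ ∘ q) ⁻¹' {x}).Finite := fun x ↦ by
    refine (hfin (φ.symm x)).subset fun y hy ↦ ?_
    simp only [Set.mem_preimage, Set.mem_singleton_iff, Function.comp_apply] at hy ⊢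
    rw [← hy, Homeomorph.symm_apply_apply]
  -- (iii) the covering input: `T = S₀'(ℂ)` over `S(ℂ)` for a finite étale `g₀ : S₀' → S₀` over `ℚ̄`
  obtain ⟨S₀', g₀, Φ, hfin₀, het₀, hqp', hΦ⟩ := hRE σ S₀ hqp hsm hirr T (φ ∘ q) hcov' hfin'
  -- the base point `s'` matching `t`
  have hs : AlgPoints.map ((baseChangeHom σ).map g₀) (Φ.symm t) = s := by
    rw [← hΦ (Φ.symm t), Φ.apply_symm_apply, Function.comp_apply, ht]
    rfl
  -- (iv) irreducibility of `S₀' ⊗_σ ℂ`: its complex points `≃ₜ T` are connected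
  haveI : ConnectedSpace (ComplexPoints ((baseChangeHom σ).obj S₀')) :=
    Φ.symm.surjective.connectedSpace Φ.symm.continuous
  refine ⟨S₀', g₀, Φ.symm t, hs, hqp',
    irreducibleSpace_baseChangeHom_obj_left_of_connectedSpace_complexPoints σ g₀ hqp' hsm het₀
      inferInstance, het₀, hfin₀, fun γ' ↦ ?_⟩
  -- the loop clause: `g(ℂ) ∘ γ'` is `q ∘ δ` for the loop `δ = Φ ∘ γ'` at `t`
  let δ : Path t t :=
    (γ'.map (Φ.continuous.comp continuous_subtype_val)).cast (Φ.apply_symm_apply t).symm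
      (Φ.apply_symm_apply t).symm
  have hpath :
      ((γ'.map ((((Motives.AlgPoints.continuous_map ((Motives.baseChangeHom σ).map g₀)).comp
          continuous_subtype_val)).subtype_mk fun _ ↦ Set.mem_univ _)).cast
        (Subtype.ext hs.symm) (Subtype.ext hs.symm) :
        Path (⟨s, Set.mem_univ s⟩ : (Set.univ : Set (ComplexPoints ((baseChangeHom σ).obj S₀))))
          ⟨s, Set.mem_univ s⟩) =
      (δ.map hqc).cast ht.symm ht.symm := by
    apply Path.ext
    funext u
    apply Subtype.ext
    change AlgPoints.map ((baseChangeHom σ).map g₀) (γ' u).1 = (φ ∘ q) (Φ (γ' u).1)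
    exact (hΦ _).symm
  rw [hpath]
  exact H.normalCore_le (hloop δ)

/-- **`riemannExistence_qbarDescent_of_finiteIndex` from Riemann's existence theorem over `ℂ` and
descent UP TO HOMEOMORPHISM over `S(ℂ)`.**  The covering input of
`riemannExistence_qbarDescent_of_finiteIndex_of_coveringInput` is supplied by the tree's
`HodgeTheory.finiteCovering_descends_to_qbar_of_riemannExistence_of_weakDescent` from (2) Riemann's
existence theorem in covering form (`hRiemann`: SGA1 XII Thm. 5.1) and (3') the WEAK descent
(`hDescent`: a finite étale cover of `S₀ ⊗_σ ℂ` is homeomorphic OVER `S(ℂ)` to the complexification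
of a finite étale cover of `S₀` — the part of SGA1 XIII Prop. 4.6 that is consumed, and the form
delivered by spreading out and specialising along a path in the parameter space,
`Topology/CoveringSpaces/CoveringSliceTransport`, `Topology/CoveringSpaces/CoveringFamilyMonodromy`),
the quasi-projectivity of the descended cover being PROVED there.
[cite: SGA1, Exp. XII Thm. 5.1 (p. 333) and Exp. XIII Prop. 4.6 (pp. 421–422)]
[cite: HatcherAT2002, §1.3 Thm. 1.38 with Prop. 1.36 and Prop. 1.32] -/
theorem riemannExistence_qbarDescent_of_finiteIndex_of_riemannExistence_of_weakDescent
    (hRiemann : ∀ (S : SchemeOver ℂ), IsQuasiProjectiveOver S →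
      ∀ (T : Type) [TopologicalSpace T] (q : T → ComplexPoints S),
        IsCoveringMap q → (∀ t, (q ⁻¹' {t}).Finite) →
        ∃ (S' : SchemeOver ℂ) (g : S' ⟶ S) (Φ : ComplexPoints S' ≃ₜ T),
          IsFinite g.left ∧ Etale g.left ∧ ∀ z, q (Φ z) = AlgPoints.map g z)
    (hDescent : ∀ (σ : AlgebraicClosure ℚ →+* ℂ) (S₀ : SchemeOver (AlgebraicClosure ℚ)),
      IsQuasiProjectiveOver S₀ → IrreducibleSpace S₀.left → AlgebraicGeometry.Smooth S₀.hom →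
      ∀ ⦃S' : SchemeOver ℂ⦄ (g : S' ⟶ (baseChangeHom σ).obj S₀),
        IsFinite g.left → Etale g.left →
        ∃ (S''₀ : SchemeOver (AlgebraicClosure ℚ)) (g₀ : S''₀ ⟶ S₀)
          (Ψ : ComplexPoints ((baseChangeHom σ).obj S''₀) ≃ₜ ComplexPoints S'),
          IsFinite g₀.left ∧ Etale g₀.left ∧
            ∀ z, AlgPoints.map g (Ψ z) = AlgPoints.map ((baseChangeHom σ).map g₀) z) :
    riemannExistence_qbarDescent_of_finiteIndex :=
  riemannExistence_qbarDescent_of_finiteIndex_of_coveringInput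
    fun σ S₀ hqp hsm hirr T _ _ q hq hqfin ↦
      finiteCovering_descends_to_qbar_of_riemannExistence_of_weakDescent hRiemann hDescent σ S₀ hqp
        hsm hirr T q hq hqfin

/-- **`riemannExistence_qbarDescent_of_finiteIndex` from Riemann's existence theorem and descent of
finite étale covers alone.**  Given (2) Riemann's existence theorem in covering form (`hRiemann`:
SGA1 XII Thm. 5.1 — a finite-fibred topological covering of `S(ℂ)`, `S` quasi-projective over `ℂ`,
is `S'(ℂ)` for a finite étale `S' → S`) and (3) descent of connected finite étale covers of
`S₀ ⊗_σ ℂ` to `S₀` (`hDescent`: SGA1 XIII Prop. 4.6 with `Y = Spec ℂ`), every finite-index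
`H ≤ π₁(S(ℂ), s)`, `S = S₀ ⊗_σ ℂ` with `S₀` smooth irreducible quasi-projective over `ℚ̄`, is realised
by a finite étale `g₀ : S₀' ⟶ S₀` over `ℚ̄`, `S₀'` quasi-projective with irreducible
complexification, and a complex point `s'` over `s` at which every loop is pushed into `H`: the
covering of the connected manifold `S(ℂ)` attached to the normal core of `H` (Hatcher Prop. 1.36,
finitely many sheets by Prop. 1.32, PROVED: `UniversalCover.exists_covering_of_normal`) is
algebraic and defined over `ℚ̄` by (2)+(3) (`finiteCovering_descends_to_qbar_of_riemannExistence_of_smooth`,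
where integrality and quasi-projectivity of the cover are PROVED), its complexification is
irreducible (`irreducibleSpace_baseChangeHom_obj_left_of_connectedSpace_complexPoints`), and loops
at the matching point push into `N ⊆ H`.
[cite: HatcherAT2002, §1.3 Thm. 1.38 with Prop. 1.36 (pp. 68–69) and Prop. 1.32 (p. 61)]
[cite: SGA1, Exp. XII Thm. 5.1 (p. 333) and Exp. XIII Prop. 4.6 (pp. 421–422)] -/
theorem riemannExistence_qbarDescent_of_finiteIndex_of_riemannExistence_of_descent
    (hRiemann : ∀ (S : SchemeOver ℂ), IsQuasiProjectiveOver S →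
      ∀ (T : Type) [TopologicalSpace T] (q : T → ComplexPoints S),
        IsCoveringMap q → (∀ t, (q ⁻¹' {t}).Finite) →
        ∃ (S' : SchemeOver ℂ) (g : S' ⟶ S) (Φ : ComplexPoints S' ≃ₜ T),
          IsFinite g.left ∧ Etale g.left ∧ ∀ z, q (Φ z) = AlgPoints.map g z)
    (hDescent : ∀ (σ : AlgebraicClosure ℚ →+* ℂ) (S₀ : SchemeOver (AlgebraicClosure ℚ)),
      IsQuasiProjectiveOver S₀ → IrreducibleSpace S₀.left →
      ∀ ⦃S' : SchemeOver ℂ⦄ (g : S' ⟶ (baseChangeHom σ).obj S₀),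
        IsFinite g.left → Etale g.left → ConnectedSpace S'.left →
        ∃ (S''₀ : SchemeOver (AlgebraicClosure ℚ)) (g₀ : S''₀ ⟶ S₀)
          (e : (baseChangeHom σ).obj S''₀ ≅ S'),
          IsFinite g₀.left ∧ Etale g₀.left ∧ e.hom ≫ g = (baseChangeHom σ).map g₀) :
    riemannExistence_qbarDescent_of_finiteIndex :=
  riemannExistence_qbarDescent_of_finiteIndex_of_coveringInput
    fun σ S₀ hqp hsm hirr T _ _ q hq hqfin ↦
      finiteCovering_descends_to_qbar_of_riemannExistence_of_smooth hRiemann hDescent σ S₀ hqp hsm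
        hirr T q hq hqfin

/-- **`riemannExistence_qbarDescent_of_finiteIndex` from Riemann's existence theorem ALONE.** The
weak descent hypothesis of
`riemannExistence_qbarDescent_of_finiteIndex_of_riemannExistence_of_weakDescent` is a theorem of the
tree (`FundamentalGroup.finiteEtaleCover_weakDescent`: spreading out, EGA IV₃ 8.8.2/8.10.5 and IV₄
17.7.8, plus transport of the fibres of the covering `X'(ℂ) → S₀(ℂ) × U(ℂ)` along a path in `U(ℂ)`
from a `ℚ̄`-point to the very general point — SGA1 XIII §4 / Voisin 2007 §3), so the named fact
follows from Riemann's existence theorem in covering form (SGA1 XII Thm. 5.1: a finite-fibred covering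
space of `S(ℂ)`, `S` quasi-projective over `ℂ`, is `S'(ℂ)` for a finite étale `S' → S`) and nothing
else. [cite: SGA1, Exp. XII Thm. 5.1 (p. 333) and Exp. XIII §4] [cite: HatcherAT2002, §1.3
Prop. 1.36 and Prop. 1.30] [cite: Voisin2007, §3] -/
theorem riemannExistence_qbarDescent_of_finiteIndex_of_riemannExistence
    (hRiemann : ∀ (S : SchemeOver ℂ), IsQuasiProjectiveOver S →
      ∀ (T : Type) [TopologicalSpace T] (q : T → ComplexPoints S),
        IsCoveringMap q → (∀ t, (q ⁻¹' {t}).Finite) →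
        ∃ (S' : SchemeOver ℂ) (g : S' ⟶ S) (Φ : ComplexPoints S' ≃ₜ T),
          IsFinite g.left ∧ Etale g.left ∧ ∀ z, q (Φ z) = AlgPoints.map g z) :
    riemannExistence_qbarDescent_of_finiteIndex :=
  riemannExistence_qbarDescent_of_finiteIndex_of_riemannExistence_of_weakDescent hRiemann
    fun σ S₀ hqp hirr hsm _ g hfin het ↦ finiteEtaleCover_weakDescent σ S₀ hqp hirr hsm g hfin het

/-- **`riemannExistence_qbarDescent_of_finiteIndex` from the tree's named fact
`riemannExistence_finiteCovering`** (Riemann's existence theorem over `ℂ` in covering form,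
SGA1 XII Thm. 5.1 — the one remaining unproved input, under its one name in the tree): the named
fact `riemannExistence_qbarDescent_of_finiteIndex` is discharged by
`riemannExistence_qbarDescent_of_finiteIndex_of_riemannExistence_finiteCovering
riemannExistence_finiteCovering_holds` the day that theorem is proved.
[cite: SGA1, Exp. XII Thm. 5.1 (p. 333)] [cite: HatcherAT2002, §1.3 Prop. 1.36] -/
theorem riemannExistence_qbarDescent_of_finiteIndex_of_riemannExistence_finiteCovering
    (h : riemannExistence_finiteCovering) : riemannExistence_qbarDescent_of_finiteIndex :=
  riemannExistence_qbarDescent_of_finiteIndex_of_riemannExistence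
    fun S hS T _ q hq hqfin ↦ h S hS T q hq hqfin

open Literature.AlgebraicGeometry.Resolution CategoryTheory.Limits in
/-- **`riemannExistence_qbarDescent_of_finiteIndex` from Riemann's existence theorem for SMOOTH
IRREDUCIBLE quasi-projective `ℂ`-schemes and CONNECTED coverings alone** — the weakest
transcendental input the fact consumes.  Every reduction above instantiates Riemann existence only
at `S = S₀ ⊗_σ ℂ`, which is smooth over `ℂ` and irreducible (its complex points form a connected
manifold, `pathConnectedSpace_complexPoints_baseChangeHom` with
`irreducibleSpace_left_of_connectedSpace_complexPoints`, SGA1 XII Prop. 2.4), and only at the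
CONNECTED covering `T → S(ℂ)` attached to the normal core of `H`; so it suffices to know SGA1 XII
Thm. 5.1 in the smooth case — the scope of Artin's proof by elementary fibrations [SGA4, Exp. XI
Thm. 4.3], which avoids the reduction to normal schemes (SGA1 IX 4.7) and the singular
Grauert–Remmert theorem: for `S` smooth, irreducible and quasi-projective over `ℂ`, every connected
covering map `q : T → S(ℂ)` with finite fibres is `S'(ℂ) → S(ℂ)` for a finite étale `g : S' ⟶ S`.
Granted that (`hRiemann`), the weak descent to `ℚ̄` is the tree's theorem
`finiteEtaleCover_weakDescent` (spreading out and path transport), the descended cover `S''₀` is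
quasi-projective because `S''₀ ⊗_σ ℂ` is smooth with connected complex points `≃ₜ T`, hence `S''₀` is
integral and finite surjective over `S₀` (`isQuasiProjectiveOver_of_isFinite_of_surjective`,
de Jong 1996, 4.17), and the rest is `riemannExistence_qbarDescent_of_finiteIndex_of_coveringInput`
(Hatcher Prop. 1.36 for the normal core of `H`).
[cite: SGA1, Exp. XII Thm. 5.1 (p. 333) and Prop. 2.4] [cite: HatcherAT2002, §1.3 Prop. 1.36 and
Prop. 1.32] [cite: DeJong1996, 4.17 (p. 72)] -/
theorem riemannExistence_qbarDescent_of_finiteIndex_of_riemannExistence_smooth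
    (hRiemann : ∀ (S : SchemeOver ℂ), IsQuasiProjectiveOver S → AlgebraicGeometry.Smooth S.hom →
      IrreducibleSpace S.left →
      ∀ (T : Type) [TopologicalSpace T] [ConnectedSpace T] (q : T → ComplexPoints S),
        IsCoveringMap q → (∀ t, (q ⁻¹' {t}).Finite) →
        ∃ (S' : SchemeOver ℂ) (g : S' ⟶ S) (Φ : ComplexPoints S' ≃ₜ T),
          IsFinite g.left ∧ Etale g.left ∧ ∀ z, q (Φ z) = AlgPoints.map g z) :
    riemannExistence_qbarDescent_of_finiteIndex := by
  refine riemannExistence_qbarDescent_of_finiteIndex_of_coveringInput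
    fun σ S₀ hqp hsm hirr T _ _ q hq hqfin ↦ ?_
  haveI := hsm
  haveI := hirr
  have hS : IsQuasiProjectiveOver ((baseChangeHom σ).obj S₀) := hqp.baseChangeHom σ
  -- `S = S₀ ⊗_σ ℂ` is smooth over `ℂ` and irreducible (connected complex manifold of points)
  haveI : AlgebraicGeometry.Smooth ((baseChangeHom σ).obj S₀).hom := by
    change AlgebraicGeometry.Smooth (pullback.snd S₀.hom _)
    infer_instance
  haveI : PathConnectedSpace (ComplexPoints ((baseChangeHom σ).obj S₀)) :=
    pathConnectedSpace_complexPoints_baseChangeHom σ hqp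
  haveI : IrreducibleSpace ((baseChangeHom σ).obj S₀).left :=
    irreducibleSpace_left_of_connectedSpace_complexPoints
  -- Riemann existence in the smooth irreducible case, for the connected covering `T`
  obtain ⟨S', g, Φ₁, hfin, het, hΦ₁⟩ := hRiemann _ hS inferInstance inferInstance T q hq hqfin
  haveI := hfin
  haveI := het
  -- weak descent to `ℚ̄` (PROVED): `S'(ℂ) ≃ₜ S''₀(ℂ)` over `S(ℂ)` for a finite étale `g₀ : S''₀ → S₀`
  obtain ⟨S''₀, g₀, Ψ, hfin₀, het₀, hΨ⟩ := finiteEtaleCover_weakDescent σ S₀ hqp hirr hsm g hfin het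
  haveI := hfin₀
  haveI := het₀
  -- `S''₀ ⊗_σ ℂ` is smooth with connected complex points, hence irreducible; so is `S''₀`
  set g' : (baseChangeHom σ).obj S''₀ ⟶ (baseChangeHom σ).obj S₀ := (baseChangeHom σ).map g₀
    with hg'
  haveI : Etale g'.left := etale_baseChangeHom_map_left σ g₀
  haveI : AlgebraicGeometry.Smooth ((baseChangeHom σ).obj S''₀).hom := by
    rw [← Over.w g']
    infer_instance
  haveI : ConnectedSpace (ComplexPoints ((baseChangeHom σ).obj S''₀)) :=
    (Ψ.trans Φ₁).symm.surjective.connectedSpace (Ψ.trans Φ₁).symm.continuous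
  haveI : IrreducibleSpace ((baseChangeHom σ).obj S''₀).left :=
    irreducibleSpace_left_of_connectedSpace_complexPoints
  haveI : IrreducibleSpace S''₀.left := irreducibleSpace_of_irreducibleSpace_baseChangeHom_obj σ S''₀
  -- `S₀` and `S''₀` are integral (smooth over `ℚ̄`, irreducible)
  have hS₀reg : Scheme.IsRegular S₀.left :=
    Scheme.IsRegular.of_smooth S₀.hom (Scheme.isRegular_Spec (CommRingCat.of (AlgebraicClosure ℚ)))
  haveI : IsReduced S₀.left := hS₀reg.isReduced
  haveI : IsIntegral S₀.left := isIntegral_of_irreducibleSpace_of_isReduced _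
  haveI : AlgebraicGeometry.Smooth S''₀.hom := by
    rw [← Over.w g₀]
    infer_instance
  have hS''reg : Scheme.IsRegular S''₀.left :=
    Scheme.IsRegular.of_smooth S''₀.hom (Scheme.isRegular_Spec (CommRingCat.of (AlgebraicClosure ℚ)))
  haveI : IsReduced S''₀.left := hS''reg.isReduced
  haveI : IsIntegral S''₀.left := isIntegral_of_irreducibleSpace_of_isReduced _
  -- `g₀` is surjective: closed (finite) and open (étale) onto the irreducible `S₀`
  haveI : Surjective g₀.left := by
    refine ⟨fun y => ?_⟩
    have huniv : Set.range g₀.left = Set.univ :=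
      IsClopen.eq_univ ⟨g₀.left.isClosedMap.isClosed_range, g₀.left.isOpenMap.isOpen_range⟩
        (Set.range_nonempty _)
    show y ∈ Set.range g₀.left
    rw [huniv]
    trivial
  refine ⟨S''₀, g₀, Ψ.trans Φ₁, hfin₀, het₀,
    isQuasiProjectiveOver_of_isFinite_of_surjective g₀ hqp, fun z ↦ ?_⟩
  rw [Homeomorph.trans_apply, hΦ₁, hΨ]

open Literature.AlgebraicGeometry.Resolution CategoryTheory.Limits in
/-- **`riemannExistence_qbarDescent_of_finiteIndex` from Riemann's existence theorem for SMOOTH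
IRREDUCIBLE AFFINE `ℂ`-schemes alone.** «Compte tenu de 1) la question est locale sur `X`, et on
peut donc supposer `X` affine» (SGA1 XII 5.1, proof, part 2): essential surjectivity of
`X' ↦ X'(ℂ)` glues along Zariski open covers (`ZariskiLocal.riemannExistence_of_affineOpens`,
`RiemannExistenceZariskiLocal.lean`: relative gluing of the local algebraisations along the
isomorphisms of full faithfulness), and the non-empty affine opens of a smooth irreducible
quasi-projective `ℂ`-scheme are smooth, irreducible (integral: smooth over a field is reduced,
`isIntegral_of_isOpenImmersion`) and affine. So the fact follows from: for every smooth irreducible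
AFFINE `ℂ`-scheme `S` and every covering map `q : T → S(ℂ)` with finite fibres (connected or not),
`T ≅ S'(ℂ)` over `S(ℂ)` for a finite étale `S' ⟶ S` — fed into
`riemannExistence_qbarDescent_of_finiteIndex_of_riemannExistence_smooth`.
[cite: SGA1, Exp. XII Thm. 5.1 (p. 333), proof, part 2] [cite: HatcherAT2002, §1.3 Prop. 1.36] -/
theorem riemannExistence_qbarDescent_of_finiteIndex_of_riemannExistence_smoothAffine
    (hRiemann : ∀ (S : SchemeOver ℂ), IsAffine S.left → AlgebraicGeometry.Smooth S.hom →
      IrreducibleSpace S.left →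
      ∀ (T : Type) [TopologicalSpace T] (q : T → ComplexPoints S),
        IsCoveringMap q → (∀ t, (q ⁻¹' {t}).Finite) →
        ∃ (S' : SchemeOver ℂ) (g : S' ⟶ S) (Φ : ComplexPoints S' ≃ₜ T),
          IsFinite g.left ∧ Etale g.left ∧ ∀ z, q (Φ z) = AlgPoints.map g z) :
    riemannExistence_qbarDescent_of_finiteIndex := by
  refine riemannExistence_qbarDescent_of_finiteIndex_of_riemannExistence_smooth
    fun S hS hsm hirr T _ _ q hq hqfin ↦ ?_
  haveI := hsm
  haveI := hirr
  haveI : LocallyOfFiniteType S.hom := hS.locallyOfFiniteType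
  haveI : IsSeparated S.hom := hS.isVarietyPair_ofScheme.isSeparated
  -- `S` is integral: smooth over `ℂ` (regular, hence reduced) and irreducible
  have hSreg : Scheme.IsRegular S.left :=
    Scheme.IsRegular.of_smooth S.hom (Scheme.isRegular_Spec (CommRingCat.of ℂ))
  haveI : IsReduced S.left := hSreg.isReduced
  haveI : IsIntegral S.left := isIntegral_of_irreducibleSpace_of_isReduced _
  refine ZariskiLocal.riemannExistence_of_affineOpens (X := S) (fun U hU hne T' _ q' hq' hfin' ↦ ?_)
    q hq hqfin
  -- the non-empty affine open `U ⊆ S` is affine, smooth over `ℂ` and irreducible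
  haveI : Nonempty (U : Scheme) := hne.to_subtype
  haveI : IsIntegral (U : Scheme) := isIntegral_of_isOpenImmersion U.ι
  haveI : IsAffine (openSubschemeOver S U).left := hU
  haveI : AlgebraicGeometry.Smooth (openSubschemeOver S U).hom :=
    inferInstanceAs (AlgebraicGeometry.Smooth (U.ι ≫ S.hom))
  haveI : IrreducibleSpace (openSubschemeOver S U).left :=
    inferInstanceAs (IrreducibleSpace (U : Scheme))
  exact hRiemann _ ‹_› ‹_› ‹_› T' q' hq' hfin'

/-- **`riemannExistence_qbarDescent_of_finiteIndex` from the existence of separating functions with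
regular characteristic polynomials.** By the algebraisation step of Riemann's existence theorem
(`CharPoly.exists_finite_etale_homeomorph_of_charPoly_of_isCoveringMap`,
`RiemannExistenceCharPoly.lean`: standard étale algebras `Γ(X, U)[τ]/(Q)` glued by the
Zariski-localness of essential surjectivity) fed into
`riemannExistence_qbarDescent_of_finiteIndex_of_riemannExistence_smoothAffine`, the fact follows
from: for every smooth irreducible AFFINE `ℂ`-scheme `S`, every covering map `q : T → S(ℂ)` with
finite fibres and every `P₀ ∈ S(ℂ)`, there are an affine open `U ∋ P₀`, a function `h : T → ℂ`
continuous on `q⁻¹(U(ℂ))` and injective on `q⁻¹(P₀)`, and a monic `Q ∈ Γ(S, U)[τ]` whose roots over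
each `P ∈ U(ℂ)`, with multiplicity, are the values of `h` on `q⁻¹(P)` — i.e. the sheets of `q` are
separated, fibre by fibre, by functions ALGEBRAIC over `S` with regular characteristic polynomial
(the output of Grauert–Remmert / GAGA / `L²` theory in the printed proofs of SGA1 XII 5.1; this
existence is the transcendental input that remains).
[cite: SGA1, Exp. XII Thm. 5.1 (p. 333), proof, part 2] [cite: StacksProject, Tag 00UE] -/
theorem riemannExistence_qbarDescent_of_finiteIndex_of_charPolys
    (H : ∀ (S : SchemeOver ℂ), IsAffine S.left → AlgebraicGeometry.Smooth S.hom →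
      IrreducibleSpace S.left →
      ∀ (T : Type) [TopologicalSpace T] (q : T → ComplexPoints S) (_ : IsCoveringMap q)
        (hfin : ∀ t, (q ⁻¹' {t}).Finite) (P₀ : ComplexPoints S),
        ∃ (U : S.left.Opens) (_ : IsAffineOpen U) (_ : P₀.pt ∈ U) (h : T → ℂ)
          (Q : Polynomial Γ(S.left, U)),
          ContinuousOn h (q ⁻¹' {P | P.pt ∈ U}) ∧ Q.Monic ∧
          (∀ (P : ComplexPoints S) (hP : P.pt ∈ U),
            (Q.map (P.evalRingHom U hP)).roots = ((hfin P).toFinset.val).map h) ∧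
          Set.InjOn h (q ⁻¹' {P₀})) :
    riemannExistence_qbarDescent_of_finiteIndex := by
  refine riemannExistence_qbarDescent_of_finiteIndex_of_riemannExistence_smoothAffine
    fun S hS hsm hirr T _ q hq hfin ↦ ?_
  haveI := hS
  haveI := hsm
  haveI : IsSeparated S.hom := inferInstance
  haveI : LocallyOfFiniteType S.hom := inferInstance
  exact CharPoly.exists_finite_etale_homeomorph_of_charPoly_of_isCoveringMap q hq hfin
    (H S hS hsm hirr T q hq hfin)

open Literature.AlgebraicGeometry.Resolution in
/-- **`riemannExistence_qbarDescent_of_finiteIndex` from the existence of integral separating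
functions.** By Theorem B (`CharPolyIntegral.exists_charPoly`: the characteristic polynomial of a
continuous function integral over `Γ(S, 𝒪_S)` along a finite covering of `S(ℂ)` is a monic REGULAR
polynomial, `S` smooth — hence normal: `Scheme.IsRegular.of_smooth`,
`isIntegrallyClosed_of_isRegularLocalRing`, `isIntegrallyClosed_sections_of_stalk`) fed into
`riemannExistence_qbarDescent_of_finiteIndex_of_charPolys` (Theorem A, the algebraisation step),
the fact follows from: for every smooth irreducible AFFINE `ℂ`-scheme `S`, every covering map
`q : T → S(ℂ)` with finite fibres and every `P₀ ∈ S(ℂ)`, there is a continuous `h : T → ℂ`,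
INTEGRAL over `Γ(S, 𝒪_S)` (`R(q t)(h t) = 0` for one monic `R ∈ Γ(S, 𝒪_S)[τ]`) and injective on
`q⁻¹(P₀)`. This existence statement — holomorphic functions of polynomial growth on the finite
covering `T`, algebraic over `ℂ(S)` — is the transcendental heart of Riemann's existence theorem
(Grauert–Remmert / GAGA / `L²`), the one input that remains.
[cite: SGA1, Exp. XII Thm. 5.1 (p. 333), proof, part 2] -/
theorem riemannExistence_qbarDescent_of_finiteIndex_of_integralSeparating
    (H : ∀ (S : SchemeOver ℂ), IsAffine S.left → AlgebraicGeometry.Smooth S.hom →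
      IrreducibleSpace S.left →
      ∀ (T : Type) [TopologicalSpace T] (q : T → ComplexPoints S) (_ : IsCoveringMap q)
        (_ : ∀ t, (q ⁻¹' {t}).Finite) (P₀ : ComplexPoints S),
        ∃ (h : T → ℂ) (R : Polynomial Γ(S.left, ⊤)), Continuous h ∧ R.Monic ∧
          (∀ t, (R.map ((q t).evalRingHom ⊤ trivial)).eval (h t) = 0) ∧
          Set.InjOn h (q ⁻¹' {P₀})) :
    riemannExistence_qbarDescent_of_finiteIndex := by
  refine riemannExistence_qbarDescent_of_finiteIndex_of_charPolys
    fun S hS hsm hirr T _ q hq hfin P₀ ↦ ?_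
  haveI := hS
  haveI := hsm
  haveI := hirr
  haveI : IsSeparated S.hom := inferInstance
  haveI : LocallyOfFiniteType S.hom := inferInstance
  -- `S` is integral and normal: smooth over `ℂ` (regular) and irreducible
  have hSreg : Scheme.IsRegular S.left :=
    Scheme.IsRegular.of_smooth S.hom (Scheme.isRegular_Spec (CommRingCat.of ℂ))
  haveI : IsReduced S.left := hSreg.isReduced
  haveI : IsIntegral S.left := isIntegral_of_irreducibleSpace_of_isReduced _
  haveI : Nonempty (⊤ : S.left.Opens) := ⟨⟨P₀.pt, trivial⟩⟩
  have hA : IsIntegrallyClosed Γ(S.left, ⊤) :=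
    isIntegrallyClosed_sections_of_stalk (Y := S.left)
      (fun y ↦ haveI := hSreg y; isIntegrallyClosed_of_isRegularLocalRing _)
      ⟨⊤, isAffineOpen_top S.left⟩
  obtain ⟨h, R, hh, hR, hroot, hinj⟩ := H S hS hsm hirr T q hq hfin P₀
  obtain ⟨Q, hQ, hroots⟩ := CharPolyIntegral.exists_charPoly (X := S) (U := ⊤)
    (isAffineOpen_top S.left) ⟨P₀.pt, trivial⟩ hA hq hfin h hh.continuousOn R hR
    (fun t _ ↦ hroot t)
  exact ⟨⊤, isAffineOpen_top S.left, trivial, h, Q, hh.continuousOn, hQ, hroots, hinj⟩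

open Literature.AlgebraicGeometry.Resolution in
/-- **`riemannExistence_qbarDescent_of_finiteIndex` from the existence of algebraic separating
functions.** By Theorem B′ (`ContinuousRational.exists_charPoly_of_algebraic`: the characteristic
polynomial of a continuous function ALGEBRAIC over `Γ(S, 𝒪_S)` along a finite covering of `S(ℂ)` is
a monic regular polynomial, `S` smooth — its local rings are regular, `Scheme.IsRegular.of_smooth`)
fed into `riemannExistence_qbarDescent_of_finiteIndex_of_charPolys` (Theorem A), the fact follows
from: for every smooth irreducible AFFINE `ℂ`-scheme `S`, every covering map `q : T → S(ℂ)` with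
finite fibres and every `P₀ ∈ S(ℂ)`, there is a continuous `h : T → ℂ` injective on `q⁻¹(P₀)` and
ALGEBRAIC over `Γ(S, 𝒪_S)`: `F(q t)(h t) = 0` for all `t`, for one non-zero `F ∈ Γ(S, 𝒪_S)[τ]`
(e.g. a holomorphic function on `T` algebraic over the function field `ℂ(S)`, denominators cleared).
This is the transcendental heart of Riemann's existence theorem, the one input that remains.
[cite: SGA1, Exp. XII Thm. 5.1 (p. 333), proof, part 2] -/
theorem riemannExistence_qbarDescent_of_finiteIndex_of_algebraicSeparating
    (H : ∀ (S : SchemeOver ℂ), IsAffine S.left → AlgebraicGeometry.Smooth S.hom →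
      IrreducibleSpace S.left →
      ∀ (T : Type) [TopologicalSpace T] (q : T → ComplexPoints S) (_ : IsCoveringMap q)
        (_ : ∀ t, (q ⁻¹' {t}).Finite) (P₀ : ComplexPoints S),
        ∃ (h : T → ℂ) (F : Polynomial Γ(S.left, ⊤)), Continuous h ∧ F ≠ 0 ∧
          (∀ t, (F.map ((q t).evalRingHom ⊤ trivial)).eval (h t) = 0) ∧
          Set.InjOn h (q ⁻¹' {P₀})) :
    riemannExistence_qbarDescent_of_finiteIndex := by
  refine riemannExistence_qbarDescent_of_finiteIndex_of_charPolys
    fun S hS hsm hirr T _ q hq hfin P₀ ↦ ?_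
  haveI := hS
  haveI := hsm
  haveI := hirr
  haveI : IsSeparated S.hom := inferInstance
  haveI : LocallyOfFiniteType S.hom := inferInstance
  -- `S` is integral with regular local rings: smooth over `ℂ` and irreducible
  have hSreg : Scheme.IsRegular S.left :=
    Scheme.IsRegular.of_smooth S.hom (Scheme.isRegular_Spec (CommRingCat.of ℂ))
  haveI : IsReduced S.left := hSreg.isReduced
  haveI : IsIntegral S.left := isIntegral_of_irreducibleSpace_of_isReduced _
  obtain ⟨h, F, hh, hF, hroot, hinj⟩ := H S hS hsm hirr T q hq hfin P₀
  obtain ⟨Q, hQ, hroots⟩ := ContinuousRational.exists_charPoly_of_algebraic (X := S) hSreg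
    (U := ⊤) (isAffineOpen_top S.left) hq hfin h hh.continuousOn F hF (fun t _ ↦ hroot t)
  exact ⟨⊤, isAffineOpen_top S.left, trivial, h, Q, hh.continuousOn, hQ, hroots, hinj⟩

open Literature.AlgebraicGeometry.Resolution in
/-- **`riemannExistence_qbarDescent_of_finiteIndex` from LOCALLY algebraic separating functions.**
The Zariski-local form of `riemannExistence_qbarDescent_of_finiteIndex_of_algebraicSeparating`,
matching what the analytic construction (weighted `L²` estimates in étale coordinates on an affine
neighbourhood of `P₀`) produces: the fact follows from — for every smooth irreducible AFFINE
`ℂ`-scheme `S`, every covering map `q : T → S(ℂ)` with finite fibres and every `P₀ ∈ S(ℂ)`, an affine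
open `U ∋ P₀` of `S`, a function `h : T → ℂ` continuous on `q⁻¹(U(ℂ))` and injective on `q⁻¹(P₀)`,
and a NON-ZERO `F ∈ Γ(S, U)[τ]` with `F(q t)(h t) = 0` whenever `q t ∈ U(ℂ)`. Theorem B′ on `U`
(`ContinuousRational.exists_charPoly_of_algebraic`, the local rings of `S` being regular) turns `F`
into the monic regular characteristic polynomial of `h` over `U`, and
`riemannExistence_qbarDescent_of_finiteIndex_of_charPolys` (Theorem A with Zariski-local gluing)
concludes. [cite: SGA1, Exp. XII Thm. 5.1 (p. 333), proof, part 2] -/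
theorem riemannExistence_qbarDescent_of_finiteIndex_of_locallyAlgebraicSeparating
    (H : ∀ (S : SchemeOver ℂ), IsAffine S.left → AlgebraicGeometry.Smooth S.hom →
      IrreducibleSpace S.left →
      ∀ (T : Type) [TopologicalSpace T] (q : T → ComplexPoints S) (_ : IsCoveringMap q)
        (_ : ∀ t, (q ⁻¹' {t}).Finite) (P₀ : ComplexPoints S),
        ∃ (U : S.left.Opens) (_ : IsAffineOpen U) (_ : P₀.pt ∈ U) (h : T → ℂ)
          (F : Polynomial Γ(S.left, U)),
          ContinuousOn h (q ⁻¹' {P | P.pt ∈ U}) ∧ F ≠ 0 ∧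
          (∀ (t : T) (ht : (q t).pt ∈ U), (F.map ((q t).evalRingHom U ht)).eval (h t) = 0) ∧
          Set.InjOn h (q ⁻¹' {P₀})) :
    riemannExistence_qbarDescent_of_finiteIndex := by
  refine riemannExistence_qbarDescent_of_finiteIndex_of_charPolys
    fun S hS hsm hirr T _ q hq hfin P₀ ↦ ?_
  haveI := hS
  haveI := hsm
  haveI := hirr
  haveI : IsSeparated S.hom := inferInstance
  haveI : LocallyOfFiniteType S.hom := inferInstance
  -- `S` is integral with regular local rings: smooth over `ℂ` and irreducible
  have hSreg : Scheme.IsRegular S.left :=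
    Scheme.IsRegular.of_smooth S.hom (Scheme.isRegular_Spec (CommRingCat.of ℂ))
  haveI : IsReduced S.left := hSreg.isReduced
  haveI : IsIntegral S.left := isIntegral_of_irreducibleSpace_of_isReduced _
  obtain ⟨U, hU, hP₀U, h, F, hh, hF, hroot, hinj⟩ := H S hS hsm hirr T q hq hfin P₀
  obtain ⟨Q, hQ, hroots⟩ := ContinuousRational.exists_charPoly_of_algebraic (X := S) hSreg
    hU hq hfin h hh F hF hroot
  exact ⟨U, hU, hP₀U, h, Q, hh, hQ, hroots, hinj⟩

end Literature.AlgebraicGeometry.FundamentalGroup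

end
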